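import Summits.ABC.IUTFork.Conditional.AbcExpOfCor312SlackContent
import Summits.ABC.IUTFork.Repair.RHOffSigmaToleranceExponent
import Summits.ABC.IUTFork.Repair.RHOffSigmaToleranceExponentFar
import Literature.IUT.LogVolume.Corollary22With
import HarnessLib

/-!
# R-H ROUND 2 EXPONENT PROGRAMME, piece F4½ — THE DEGREE-ONE CURRENCY (rh-lead R19 / 01:31:34Z «shape (c)»: ALL abc triples, exponent `3/μ₀`,
# TRANSFER-FREE, F1-free): the θ-cut doors of p481829 composed BY NAME with abc-iut-rh2-xi-1's `RH.OffSigma.abc_exp_of_dilatedDisplay_degOne` (p481071)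

PROOF-ONLY sequel (no `def`, no new `Prop`, no instance, no notation; nothing re-typed) of `Conditional/AbcExpOfCor312SlackContent.lean` (abc-iut-rh2-q2-cond
gen 3, p481829) by the same seat. THE POINT (R19, EXP-SPEC v0.2 §7): the printed [GenEll] Thm. 2.1 mechanism transfers compactly-bounded Vojta to ALL points only
at exponent `1`, so at `Λ = 1/μ₀ > 1` the all-triples end needs a hypothesis not in print (shape (b)) and the exponent-`1/μ₀` end of record is the far-from-cusps
FAMILY (shape (a)); abc-iut-S6 / abc-iut-rh2-xi-1's DEGREE-ONE line needs NO transfer — [IUTchIV] Cor. 2.2 (ii) re-run at the rational point `λ = a/c` of the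
triple turns the `1/μ₀`-dilated display THERE into `c < C_ε·rad(abc)^{3/μ₀+ε}` for EVERY abc triple (base exponent `3` instead of `1`; xi-1 p481071, EXP-REF
PASS B26). This file is that currency for the ε-SLACK doors of p481829 (the σ-form twin is abc-iut-rh2-T-1's `Conditional/AbcExpOfSigmaMassDegOne.lean`, p483681,
which already routes through p481829's `displayWith_inv_iff`): any Σ-certificate lane holding a number-level remainder `ε(P,l,T)` (q2-eq rows 3/4/5's `R_σ(T)`,
q2-hull's off-Σ remainders, an `S_H|Σ` window certificate) plugs in WITHOUT passing through a sharp setting.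

WHAT IS TYPED (`0 < μ₀ ≤ 1`; content locus «`6·(1 + 20·d_mod/l)·(log-diff + log-cond) + 120·d*_mod·l < log q^{∤{2,l}}(λ)`» of abc-iut-C-cert-1; conclusions
`∀ ε' > 0, ∃ C > 0, ∀ abc triples (a, b, c), c < C·rad(abc)^{3/μ₀ + ε'}`):
* §1 **`abc_exp_three_div_of_cor312Slack_mu_content_hregC`** — explicit 3 = [NUMΣ-C] `T.negAbsLogQ ≤ T.negLogTheta + ε P l T` (p476943 VERBATIM) · [MU-C]
  `OffSigmaTolerance (1 − μ₀) (SigmaMass.tol P l) T (ε P l T)` · [CONE-C] `hregC` (p460293 VERBATIM), all ONLY on the content locus ⟹ exponent `3/μ₀` for ALL triples: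
  p481829 §3 `thm110LegendreWith_of_cor312Slack_mu_content_hregC` ⟹ (`displayWith_inv_iff`) xi-1's dilated-display hypothesis at every admissible point, a
  fortiori at the rational ones ⟹ `abc_exp_of_dilatedDisplay_degOne`;
* §2 **`abc_exp_three_div_of_displayWith_content`** — the Λ-generic POINTWISE socket (abc-iut-C-cert-1 machinery, p481829 §1) in the degree-one currency: the
  caller's `Cor22.DisplayWith P l η (1/μ₀)` (abc-iut-rh2-exp-iut p483174) at the admissible `(λ, l)` ON THE CONTENT LOCUS ⟹ exponent `3/μ₀` for ALL triples;
* §3 **`abc_exp_three_div_of_datumDisplayWith_content_hregC`** — the DATUM socket (p481829 §2): the dilated display supplied per genuine datum `T` carrying its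
  hull estimate `T.HullEstimateOf (B_III(P,l))`, plus [CONE-C] `hregC` ⟹ exponent `3/μ₀` for ALL triples.
`μ₀ = 1`: exponent `3 + ε'` — abc-iut-S6's degree-one line of record (`abc_exp_three_of_thm110LegendreUpTo_one`); the exponent-`1` end at `μ₀ = 1` is p481829 §4 /
p476943 (`ABC`). HONEST FRAMING: CONDITIONAL; «the inequality follows from these hypotheses AS TYPED», nothing more; `h312C` / `hMuC` / `hregC` / `hdispC` / `hdatC`
are ASSUMPTION LABELS, never asserted; whether genuine data supply a relative slack `μ(T) ≥ μ₀ > 0` on the content locus is OPEN (Q3 / round 3); for a FREE `ε`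
the empty-certificate band of rh2-ref-3 (D) applies ([NUMΣ-C] with `ε := T.gap`-sized remainders is free and [MU-C] then reads `μ₀·T.gap ≤ Tol(P,l)`, inhabited
on part of the locus iff `μ₀ < 1/4`); nothing here asserts that abc is proved or refuted, or that [IUTchIII] Cor. 3.12 / [IUTchIV] Thm. 1.10 holds or fails
at any datum; no side taken on any author (Mochizuki / Scholze–Stix / Joshi / Dupuy–Hilado); typed ≠ proved; instantiated ≠ endorsed.
[cite: Mochizuki2012, IUTchIV Thm. 1.10 pp. 22–31; Cor. 2.2 (ii)–(iii) pp. 41–48; Thm. A p. 3] [cite: Mochizuki2012, IUTchIII Cor. 3.12 p. 174]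
[claim: Mochizuki2012, status: disputed]
-/

noncomputable section

namespace Summit.ABC.IUTFork.Conditional.Cor312Slack

open Literature.IUT.LogVolume Literature.IUT.HodgeTheaters Literature.NumberTheory.DiophantineGeometry
  Literature.NumberTheory.DiophantineGeometry.GenEll Summit.ABC.ABC.Theorems NumberField IsDedekindDomain

/-! ## §1 The μ-slack door in the degree-one currency: exponent `3/μ₀` for every abc triple -/

/-- **`abc_exp_three_div_of_cor312Slack_mu_content_hregC` — shape (c) for the ε-slack door (F1-free, transfer-free, ALL triples).** For `0 < μ₀ ≤ 1`:
[NUMΣ-C] `T.negAbsLogQ ≤ T.negLogTheta + ε P l T` at every genuine Θ-volume datum of every admissible `(λ, l)` ON THE CONTENT LOCUS (p476943 VERBATIM) ·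
[MU-C] `OffSigmaTolerance (1 − μ₀) (SigmaMass.tol P l) T (ε P l T)` there (`ε ≤ (1−μ₀)·T.gap + Tol(P,l)`) · [CONE-C] `hregC` VERBATIM ⟹ for every `ε' > 0`
there is `C > 0` with **`c < C·rad(abc)^{3/μ₀ + ε'}` for EVERY abc triple**. ONE λ-term: p481829 §3 (the `1/μ₀`-dilated display at every admissible point)
⟹ `displayWith_inv_iff` ⟹ abc-iut-rh2-xi-1's `RH.OffSigma.abc_exp_of_dilatedDisplay_degOne` (used only at the RATIONAL points). CONDITIONAL; nothing is
asserted about the hypotheses; no side taken. [cite: Mochizuki2012, IUTchIV Thm. 1.10 pp. 22–31; Cor. 2.2 (ii)–(iii) pp. 41–48]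
[cite: Mochizuki2012, IUTchIII Cor. 3.12 p. 174] [claim: Mochizuki2012, status: disputed] -/
theorem abc_exp_three_div_of_cor312Slack_mu_content_hregC (μ₀ : ℝ) (hμ₀ : 0 < μ₀) (hμ₁ : μ₀ ≤ 1)
    (ε : ∀ (P : NFPoint) (l : ℕ), Cor22.ThetaVolumeDatumAt P l → ℝ)
    -- [NUMΣ-C] the weakened number-level Corollary with slack `ε`, demanded ONLY on the content locus (p476943 VERBATIM)
    (h312C : ∀ P : NFPoint, P ∈ UP → ∀ l : ℕ, l.Prime → 5 ≤ l →
      Cor22.AdmitsCore P → Cor22.CondP2 P l → Cor22.CondP5 P l → Cor22.CondP6 P l →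
      6 * ((1 + 20 * (Cor22.dmod P : ℝ) / l) * (P.logDiff + Cor22.logCondAvoid P {2, l}))
          + 120 * (2 ^ 12 * 3 ^ 3 * 5 * (Cor22.dmod P : ℝ) * l) < Cor22.logQAvoid P {2, l} →
      ∀ T : Cor22.ThetaVolumeDatumAt P l, T.negAbsLogQ ≤ T.negLogTheta + ε P l T)
    -- [MU-C] the slack is within the RELATIVE tolerance `(1 − μ₀)·T.gap + Tol(P,l)`, demanded ONLY there
    (hMuC : ∀ P : NFPoint, P ∈ UP → ∀ l : ℕ, l.Prime → 5 ≤ l →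
      Cor22.AdmitsCore P → Cor22.CondP2 P l → Cor22.CondP5 P l → Cor22.CondP6 P l →
      6 * ((1 + 20 * (Cor22.dmod P : ℝ) / l) * (P.logDiff + Cor22.logCondAvoid P {2, l}))
          + 120 * (2 ^ 12 * 3 ^ 3 * 5 * (Cor22.dmod P : ℝ) * l) < Cor22.logQAvoid P {2, l} →
      ∀ T : Cor22.ThetaVolumeDatumAt P l, Repair.RH.OffSigma.OffSigmaTolerance (1 - μ₀) (SigmaMass.tol P l) T (ε P l T))
    -- [CONE-C] abc-iut-C-cert-1's `hregC` VERBATIM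
    (hregC : ∀ P : NFPoint, P ∈ UP → ∀ l : ℕ, l.Prime → 5 ≤ l →
      Cor22.AdmitsCore P → Cor22.CondP2 P l → Cor22.CondP5 P l → Cor22.CondP6 P l →
      6 * ((1 + 20 * (Cor22.dmod P : ℝ) / l) * (P.logDiff + Cor22.logCondAvoid P {2, l}))
          + 120 * (2 ^ 12 * 3 ^ 3 * 5 * (Cor22.dmod P : ℝ) * l) < Cor22.logQAvoid P {2, l} →
      ∀ T : Cor22.ThetaVolumeDatumAt P l,
        (letI := T.instFieldF; letI := T.instNumberFieldF; letI := T.instAlgebraF; letI := T.instFieldK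
         letI := T.instNumberFieldK; letI := T.instAlgebraK; letI := T.instFieldFbar; letI := T.instAlgebraFbar
         letI := T.instAlgebraKFbar; letI := T.instIsElliptic
         ¬ (∀ p ∈ T.I.supportPrimes, ∀ v w : placesOver (fieldOfModuli T.E) p,
            (Summit.ABC.IUTFork.DHData.ofInput T.I).logQloc p v = (Summit.ABC.IUTFork.DHData.ofInput T.I).logQloc p w)) →
        T.HullEstimateOf
          (((l : ℝ) + 1) / 4 *
            ((1 + 12 * (Cor22.dmod P : ℝ) / l) * (P.logDiff + Cor22.logCondAvoid P {2, l})
              + 2 * Real.log l + 52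
              + 20 / 3 * Real.log (((2 ^ 12 * 3 ^ 3 * 5 * Cor22.dmod P : ℕ) : ℝ) * (l : ℝ))
                * (Nat.primeCounting (2 ^ 12 * 3 ^ 3 * 5 * Cor22.dmod P * l) : ℝ))))
    {ε' : ℝ} (hε' : 0 < ε') :
    ∃ C : ℝ, 0 < C ∧ ∀ a b c : ℕ, IsABCTriple a b c → (c : ℝ) < C * ((rad a b c : ℕ) : ℝ) ^ (3 / μ₀ + ε') :=
  Repair.RH.OffSigma.abc_exp_of_dilatedDisplay_degOne hμ₀ hμ₁
    (fun η hη P hP _ l hl h5 hcore hP2 hP5 hP6 => (displayWith_inv_iff hμ₀).1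
      (thm110LegendreWith_of_cor312Slack_mu_content_hregC μ₀ hμ₀ hμ₁ ε h312C hMuC hregC η hη P hP l hl h5 hcore hP2 hP5 hP6)) hε'

/-! ## §2 The Λ-generic pointwise socket in the degree-one currency -/

/-- **`abc_exp_three_div_of_displayWith_content` — shape (c) for the POINTWISE door** (`0 < μ₀ ≤ 1`): IF at every `η_prm`, every admissible `(λ, l)` with `l ≠ 5`
ON THE CONTENT LOCUS the caller supplies abc-iut-rh2-exp-iut's `Cor22.DisplayWith P l η_prm (1/μ₀)` [hdispC — ASSUMPTION LABEL; off the locus it is free,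
p481829 `displayWith_of_not_content`], THEN `∀ ε' > 0, ∃ C > 0`, **`c < C·rad(abc)^{3/μ₀ + ε'}` for EVERY abc triple** — p481829 §1 ⟹ `displayWith_inv_iff` ⟹
xi-1 p481071. CONDITIONAL on `hdispC`; no side taken. [cite: Mochizuki2012, IUTchIV Thm. 1.10 pp. 22–23; Cor. 2.2 (ii)–(iii) pp. 41–48] [claim: Mochizuki2012, status: disputed] -/
theorem abc_exp_three_div_of_displayWith_content (μ₀ : ℝ) (hμ₀ : 0 < μ₀) (hμ₁ : μ₀ ≤ 1)
    (hdispC : ∀ η : ℝ, IsEtaPrm η → ∀ P : NFPoint, P ∈ UP → ∀ l : ℕ, l.Prime → 5 ≤ l → l ≠ 5 →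
      Cor22.AdmitsCore P → Cor22.CondP2 P l → Cor22.CondP5 P l → Cor22.CondP6 P l →
      6 * ((1 + 20 * (Cor22.dmod P : ℝ) / l) * (P.logDiff + Cor22.logCondAvoid P {2, l}))
          + 120 * (2 ^ 12 * 3 ^ 3 * 5 * (Cor22.dmod P : ℝ) * l) < Cor22.logQAvoid P {2, l} →
      Cor22.DisplayWith P l η (1 / μ₀))
    {ε' : ℝ} (hε' : 0 < ε') :
    ∃ C : ℝ, 0 < C ∧ ∀ a b c : ℕ, IsABCTriple a b c → (c : ℝ) < C * ((rad a b c : ℕ) : ℝ) ^ (3 / μ₀ + ε') :=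
  Repair.RH.OffSigma.abc_exp_of_dilatedDisplay_degOne hμ₀ hμ₁
    (fun η hη P hP _ l hl h5 hcore hP2 hP5 hP6 => (displayWith_inv_iff hμ₀).1
      (thm110LegendreWith_of_displayWith_content (1 / μ₀) (by rw [le_div_iff₀ hμ₀, one_mul]; exact hμ₁) hdispC
        η hη P hP l hl h5 hcore hP2 hP5 hP6)) hε'

/-! ## §3 The datum socket in the degree-one currency -/

/-- **`abc_exp_three_div_of_datumDisplayWith_content_hregC` — shape (c) for the DATUM door** (`0 < μ₀ ≤ 1`): [hdatC — SOCKET] ON THE CONTENT LOCUS the caller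
supplies `Cor22.DisplayWith P l η_prm (1/μ₀)` GIVEN a genuine Θ-volume datum `T` CARRYING its hull estimate `T.HullEstimateOf (B_III(P,l))` (which [CONE-C] `hregC`
VERBATIM produces through p476943 §1) ⟹ `∀ ε' > 0, ∃ C > 0`, **`c < C·rad(abc)^{3/μ₀ + ε'}` for EVERY abc triple** — p481829 §2 ⟹ `displayWith_inv_iff` ⟹
xi-1 p481071. CONDITIONAL on `hdatC`, `hregC`; no side taken. [cite: Mochizuki2012, IUTchIV Thm. 1.10 pp. 22–31 (Step (v) pp. 27–28); Cor. 2.2 (ii)–(iii) pp. 41–48]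
[claim: Mochizuki2012, status: disputed] -/
theorem abc_exp_three_div_of_datumDisplayWith_content_hregC (μ₀ : ℝ) (hμ₀ : 0 < μ₀) (hμ₁ : μ₀ ≤ 1)
    (hdatC : ∀ η : ℝ, IsEtaPrm η → ∀ P : NFPoint, P ∈ UP → ∀ l : ℕ, l.Prime → 5 ≤ l → l ≠ 5 →
      Cor22.AdmitsCore P → Cor22.CondP2 P l → Cor22.CondP5 P l → Cor22.CondP6 P l →
      6 * ((1 + 20 * (Cor22.dmod P : ℝ) / l) * (P.logDiff + Cor22.logCondAvoid P {2, l}))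
          + 120 * (2 ^ 12 * 3 ^ 3 * 5 * (Cor22.dmod P : ℝ) * l) < Cor22.logQAvoid P {2, l} →
      ∀ T : Cor22.ThetaVolumeDatumAt P l,
        T.HullEstimateOf
          (((l : ℝ) + 1) / 4 *
            ((1 + 12 * (Cor22.dmod P : ℝ) / l) * (P.logDiff + Cor22.logCondAvoid P {2, l})
              + 2 * Real.log l + 52
              + 20 / 3 * Real.log (((2 ^ 12 * 3 ^ 3 * 5 * Cor22.dmod P : ℕ) : ℝ) * (l : ℝ))
                * (Nat.primeCounting (2 ^ 12 * 3 ^ 3 * 5 * Cor22.dmod P * l) : ℝ))) →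
        Cor22.DisplayWith P l η (1 / μ₀))
    (hregC : ∀ P : NFPoint, P ∈ UP → ∀ l : ℕ, l.Prime → 5 ≤ l →
      Cor22.AdmitsCore P → Cor22.CondP2 P l → Cor22.CondP5 P l → Cor22.CondP6 P l →
      6 * ((1 + 20 * (Cor22.dmod P : ℝ) / l) * (P.logDiff + Cor22.logCondAvoid P {2, l}))
          + 120 * (2 ^ 12 * 3 ^ 3 * 5 * (Cor22.dmod P : ℝ) * l) < Cor22.logQAvoid P {2, l} →
      ∀ T : Cor22.ThetaVolumeDatumAt P l,
        (letI := T.instFieldF; letI := T.instNumberFieldF; letI := T.instAlgebraF; letI := T.instFieldK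
         letI := T.instNumberFieldK; letI := T.instAlgebraK; letI := T.instFieldFbar; letI := T.instAlgebraFbar
         letI := T.instAlgebraKFbar; letI := T.instIsElliptic
         ¬ (∀ p ∈ T.I.supportPrimes, ∀ v w : placesOver (fieldOfModuli T.E) p,
            (Summit.ABC.IUTFork.DHData.ofInput T.I).logQloc p v = (Summit.ABC.IUTFork.DHData.ofInput T.I).logQloc p w)) →
        T.HullEstimateOf
          (((l : ℝ) + 1) / 4 *
            ((1 + 12 * (Cor22.dmod P : ℝ) / l) * (P.logDiff + Cor22.logCondAvoid P {2, l})
              + 2 * Real.log l + 52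
              + 20 / 3 * Real.log (((2 ^ 12 * 3 ^ 3 * 5 * Cor22.dmod P : ℕ) : ℝ) * (l : ℝ))
                * (Nat.primeCounting (2 ^ 12 * 3 ^ 3 * 5 * Cor22.dmod P * l) : ℝ))))
    {ε' : ℝ} (hε' : 0 < ε') :
    ∃ C : ℝ, 0 < C ∧ ∀ a b c : ℕ, IsABCTriple a b c → (c : ℝ) < C * ((rad a b c : ℕ) : ℝ) ^ (3 / μ₀ + ε') :=
  Repair.RH.OffSigma.abc_exp_of_dilatedDisplay_degOne hμ₀ hμ₁
    (fun η hη P hP _ l hl h5 hcore hP2 hP5 hP6 => (displayWith_inv_iff hμ₀).1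
      (thm110LegendreWith_of_datumDisplayWith_content_hregC (1 / μ₀) (by rw [le_div_iff₀ hμ₀, one_mul]; exact hμ₁) hdatC hregC
        η hη P hP l hl h5 hcore hP2 hP5 hP6)) hε'

/-! ## §4 (append, rh-lead RULING R21 «F5(a) PRIMARY PATH = DEGREE ONE», 2026-08-27T01:44:42Z) R19 SHAPE (a) AT DEGREE ONE: abc WITH EXPONENT `1/μ₀` ON EVERY
FAR-FROM-CUSPS FAMILY — transfer-free AND without the [IUTchIV] §2 `Λ`-port, by abc-iut-rh2-xi-1's `RH.OffSigma.abcExpOn_farFromCusps_of_dilatedDisplay_degOne`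
(`Repair/RHOffSigmaToleranceExponentFar.lean`: at `d = 1` abc-iut-S6's `arith_core` bounds `log (abc)_odd`, and `ρ⁵·c³ ≤ (abc)_odd` on a `ρ`-far family) -/

/-- **R19 SHAPE (a) AT DEGREE ONE — `ABCExpOn_farFromCusps_of_cor312Slack_mu_content_hregC_degOne` (F1 currency, transfer-free, no `Λ`-port).** For `0 < μ₀ ≤ 1`:
[NUMΣ-C] · [MU-C] · [CONE-C] on the content locus (the binders of §1 VERBATIM) ⟹ for every `0 < ρ ≤ 1/2`,
**`GenEll.ABCWithExponentOn {P | P.FarFromCusps {2} ρ} (1/μ₀)`**: `∀ ε' > 0, ∃ C = C(ρ, ε') > 0`, `c < C·rad(abc)^{(1/μ₀)·(1+ε')}` for all abc triples whose point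
`λ = a/c` is `ρ`-far from the cusps at `∞` and `2` (abc-iut-rh-typ-7's `farFromCusps_ratPoint_triple_iff`: `min(a, b) > ρ·c ∧ 2^{v₂(abc)} ≤ 1/ρ`). ONE λ-term:
p481829 §3 (the `1/μ₀`-dilated display at every admissible point) ⟹ `displayWith_inv_iff` ⟹ xi-1's theorem (used only at the RATIONAL points). THE MORNING SENTENCE's
shape (a) in the ε-currency: «a certificate leaving slack `ε ≤ (1−μ₀)·M + Tol` on the content locus, plus the θ-certificate cone cut, gives abc with exponent `1/μ₀`
on every far-from-cusps family — as typed»; no single such family contains all triples (R19); the all-triples twins are §1 (exponent `3/μ₀`) and the `Λ`-port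
end under the NAMED not-in-print hypothesis (`AbcExpOfCor312SlackContentEnds`). CONDITIONAL; nothing asserted about the hypotheses; no side taken.
[cite: Mochizuki2012, IUTchIV Thm. 1.10 pp. 22–31; Cor. 2.2 (ii)–(iii) pp. 41–48] [cite: MochizukiGenEll2010, Thm 2.1 p.12] [cite: Mochizuki2012, IUTchIII Cor. 3.12 p. 174]
[claim: Mochizuki2012, status: disputed] -/
theorem ABCExpOn_farFromCusps_of_cor312Slack_mu_content_hregC_degOne (μ₀ : ℝ) (hμ₀ : 0 < μ₀) (hμ₁ : μ₀ ≤ 1)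
    (ε : ∀ (P : NFPoint) (l : ℕ), Cor22.ThetaVolumeDatumAt P l → ℝ)
    (h312C : ∀ P : NFPoint, P ∈ UP → ∀ l : ℕ, l.Prime → 5 ≤ l →
      Cor22.AdmitsCore P → Cor22.CondP2 P l → Cor22.CondP5 P l → Cor22.CondP6 P l →
      6 * ((1 + 20 * (Cor22.dmod P : ℝ) / l) * (P.logDiff + Cor22.logCondAvoid P {2, l}))
          + 120 * (2 ^ 12 * 3 ^ 3 * 5 * (Cor22.dmod P : ℝ) * l) < Cor22.logQAvoid P {2, l} →
      ∀ T : Cor22.ThetaVolumeDatumAt P l, T.negAbsLogQ ≤ T.negLogTheta + ε P l T)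
    (hMuC : ∀ P : NFPoint, P ∈ UP → ∀ l : ℕ, l.Prime → 5 ≤ l →
      Cor22.AdmitsCore P → Cor22.CondP2 P l → Cor22.CondP5 P l → Cor22.CondP6 P l →
      6 * ((1 + 20 * (Cor22.dmod P : ℝ) / l) * (P.logDiff + Cor22.logCondAvoid P {2, l}))
          + 120 * (2 ^ 12 * 3 ^ 3 * 5 * (Cor22.dmod P : ℝ) * l) < Cor22.logQAvoid P {2, l} →
      ∀ T : Cor22.ThetaVolumeDatumAt P l, Repair.RH.OffSigma.OffSigmaTolerance (1 - μ₀) (SigmaMass.tol P l) T (ε P l T))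
    (hregC : ∀ P : NFPoint, P ∈ UP → ∀ l : ℕ, l.Prime → 5 ≤ l →
      Cor22.AdmitsCore P → Cor22.CondP2 P l → Cor22.CondP5 P l → Cor22.CondP6 P l →
      6 * ((1 + 20 * (Cor22.dmod P : ℝ) / l) * (P.logDiff + Cor22.logCondAvoid P {2, l}))
          + 120 * (2 ^ 12 * 3 ^ 3 * 5 * (Cor22.dmod P : ℝ) * l) < Cor22.logQAvoid P {2, l} →
      ∀ T : Cor22.ThetaVolumeDatumAt P l,
        (letI := T.instFieldF; letI := T.instNumberFieldF; letI := T.instAlgebraF; letI := T.instFieldK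
         letI := T.instNumberFieldK; letI := T.instAlgebraK; letI := T.instFieldFbar; letI := T.instAlgebraFbar
         letI := T.instAlgebraKFbar; letI := T.instIsElliptic
         ¬ (∀ p ∈ T.I.supportPrimes, ∀ v w : placesOver (fieldOfModuli T.E) p,
            (Summit.ABC.IUTFork.DHData.ofInput T.I).logQloc p v = (Summit.ABC.IUTFork.DHData.ofInput T.I).logQloc p w)) →
        T.HullEstimateOf
          (((l : ℝ) + 1) / 4 *
            ((1 + 12 * (Cor22.dmod P : ℝ) / l) * (P.logDiff + Cor22.logCondAvoid P {2, l})
              + 2 * Real.log l + 52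
              + 20 / 3 * Real.log (((2 ^ 12 * 3 ^ 3 * 5 * Cor22.dmod P : ℕ) : ℝ) * (l : ℝ))
                * (Nat.primeCounting (2 ^ 12 * 3 ^ 3 * 5 * Cor22.dmod P * l) : ℝ))))
    {ρ : ℝ} (h0 : 0 < ρ) (h2 : ρ ≤ 1 / 2) :
    ABCWithExponentOn {P : NFPoint | P.FarFromCusps ({2} : Finset ℕ) ρ} (1 / μ₀) :=
  Repair.RH.OffSigma.abcExpOn_farFromCusps_of_dilatedDisplay_degOne hμ₀ hμ₁
    (fun η hη P hP _ l hl h5 hcore hP2 hP5 hP6 => (displayWith_inv_iff hμ₀).1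
      (thm110LegendreWith_of_cor312Slack_mu_content_hregC μ₀ hμ₀ hμ₁ ε h312C hMuC hregC η hη P hP l hl h5 hcore hP2 hP5 hP6)) h0 h2

/-- **Shape (a) at degree one for the POINTWISE socket** (`0 < μ₀ ≤ 1`): the caller's `Cor22.DisplayWith P l η_prm (1/μ₀)` at the admissible `(λ, l)` (`l ≠ 5`) ON
THE CONTENT LOCUS [hdispC] ⟹ for every `0 < ρ ≤ 1/2`, `GenEll.ABCWithExponentOn {P | P.FarFromCusps {2} ρ} (1/μ₀)` — p481829 §1 ⟹ `displayWith_inv_iff` ⟹ xi-1.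
CONDITIONAL on `hdispC`; no side taken. [cite: Mochizuki2012, IUTchIV Thm. 1.10 pp. 22–23; Cor. 2.2 (ii)–(iii) pp. 41–48] [cite: MochizukiGenEll2010, Thm 2.1 p.12]
[claim: Mochizuki2012, status: disputed] -/
theorem ABCExpOn_farFromCusps_of_displayWith_content_degOne (μ₀ : ℝ) (hμ₀ : 0 < μ₀) (hμ₁ : μ₀ ≤ 1)
    (hdispC : ∀ η : ℝ, IsEtaPrm η → ∀ P : NFPoint, P ∈ UP → ∀ l : ℕ, l.Prime → 5 ≤ l → l ≠ 5 →
      Cor22.AdmitsCore P → Cor22.CondP2 P l → Cor22.CondP5 P l → Cor22.CondP6 P l →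
      6 * ((1 + 20 * (Cor22.dmod P : ℝ) / l) * (P.logDiff + Cor22.logCondAvoid P {2, l}))
          + 120 * (2 ^ 12 * 3 ^ 3 * 5 * (Cor22.dmod P : ℝ) * l) < Cor22.logQAvoid P {2, l} →
      Cor22.DisplayWith P l η (1 / μ₀))
    {ρ : ℝ} (h0 : 0 < ρ) (h2 : ρ ≤ 1 / 2) :
    ABCWithExponentOn {P : NFPoint | P.FarFromCusps ({2} : Finset ℕ) ρ} (1 / μ₀) :=
  Repair.RH.OffSigma.abcExpOn_farFromCusps_of_dilatedDisplay_degOne hμ₀ hμ₁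
    (fun η hη P hP _ l hl h5 hcore hP2 hP5 hP6 => (displayWith_inv_iff hμ₀).1
      (thm110LegendreWith_of_displayWith_content (1 / μ₀) (by rw [le_div_iff₀ hμ₀, one_mul]; exact hμ₁) hdispC
        η hη P hP l hl h5 hcore hP2 hP5 hP6)) h0 h2

end Summit.ABC.IUTFork.Conditional.Cor312Slack

end
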